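import Literature.Geometry.Symplectic.LefschetzSteinOpenBookKasUnique
import Literature.Geometry.Symplectic.OpenBookTransport
import Literature.Geometry.Symplectic.SteinDomainDiffeomorph
import Literature.Topology.FourManifolds.HandleAttachingMapsUniqueness
import HarnessLib

/-!
# PALF ⇒ Stein with supported boundary open book: the conclusion does not depend on the model
# of the Lefschetz handlebody (transport along diffeomorphisms of multi-attachments)

Topic `Literature/Geometry/Symplectic`; a proofs-only companion of `LefschetzSteinOpenBook.lean`
(the named fact `Literature.Geometry.Symplectic.palf_stein_supportedByBoundaryOpenBook`,
Akbulut–Ozbagci 2001, Thm. 5 with Gay 2002, Prop. 2.8).  Everything here is PROVED; no definition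
and no named fact is introduced.

The fact quantifies over EVERY realisation of the Lefschetz handlebody `X = Base g ∪_h (2-handles)`
as an abstract Kosinski multi-attachment `D : MultiAttachmentData h (𝓡∂ 4) X`, every boundary datum
`bX` of `X` and every Kas open book `ob` of `bX` (`IsKasOpenBookOf`), and asks for a Stein
structure on `X` with a Giroux form on `bX.carrier`, positive for the complex boundary
orientation.  This file proves that this CONCLUSION is transported along the canonical
identifications, so that it suffices to establish it for ONE model per attaching datum `(g, h)`:

* `MultiAttachmentData.exists_diffeomorph_apply_eq` — two multi-attachments `(X₀, D₀)`, `(X, D)`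
  along the same attaching maps are diffeomorphic BY A DIFFEOMORPHISM COMPATIBLE WITH THE PIECES,
  `e ∘ D₀.jA = D.jA`, `e ∘ D₀.jB i = D.jB i` (Kosinski 1993, VI §1, proof of (1.1): the comparison
  map; the tree's `IsMultiAttachment.nonempty_diffeomorph` with the equations kept);
* `mem_contactPlane_comap_iff` — the complex tangencies of the transported Stein structure
  `S.comap e` (`SteinDomainDiffeomorph.lean`) at a boundary point are the preimage under `De` of
  those of `S` (`SteinStructure.contactPlane_eq`: `ξ = ker dφ ∩ ker d^ℂφ` along `∂W`);
  `boundaryPlaneField_comap_symm` — read on boundary data through the restricted diffeomorphism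
  `∂e : bX₀.carrier ≅ bX.carrier` (`BoundaryData.restrictDiffeomorph`), the pulled-back plane
  field of `S₀.comap e⁻¹` on `bX` is the transport of that of `S₀` on `bX₀`;
* `IsKasOpenBookOf.map` — the open book `(∂e)_* ob₀` (`OpenBook.map`, `OpenBookTransport.lean`)
  of a Kas open book of `(D₀, bX₀)` is a Kas open book of `(D, bX)`;
* `palf_conclusion_transport` — **the conclusion of the fact for `(X₀, D₀, bX₀, ob₀)` implies it
  for `(X, D, bX, ob)`**: transport the Stein structure (`SteinStructure.comap`), the Giroux form
  (`OpenBook.IsGirouxForm.map`) to `(∂e)_* ob₀`, pass to the given Kas open book `ob`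
  (`IsKasOpenBookOf.isGirouxForm_iff`, `LefschetzSteinOpenBookKasUnique.lean`: (K1)–(K2) determine
  the Giroux forms), and transport the positivity clause (naturality of `α ∧ dα`, chain rule:
  the frames of `∂ Base g` are unchanged since `e ∘ D₀.jA = D.jA`);
* `palf_stein_supportedByBoundaryOpenBook_of_models` — **the fact follows from its conclusion on
  one model `(X₀, D₀, bX₀, ob₀)` for each positive allowable attaching datum `(g, h)`**.

## References
* S. Akbulut, B. Ozbagci, *Lefschetz fibrations on compact Stein surfaces*, Geom. Topol. 5
  (2001), Thm. 5. [AkbulutOzbagci2001]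
* A. A. Kosinski, *Differential Manifolds* (1993), VI §1 (proof of (1.1)), VI §6. [Kosinski1993]
* J. B. Etnyre, *Lectures on open book decompositions and contact structures* (2006), Def. 3.2.
  [Etnyre2006]
-/

noncomputable section

open scoped Manifold ContDiff Topology
open Set Function Filter

namespace Literature.Geometry.Symplectic

open Literature.Topology.FourManifolds Literature.Topology.FourManifolds.HandleAttachingMap
  Literature.Topology.FourManifolds.LefschetzBase Literature.Geometry.Kaehler

universe u

/-! ### Compatible diffeomorphisms between multi-attachments -/

section Compatible

variable {n k : ℕ} {M : Type*} [TopologicalSpace M] [ChartedSpace (EuclideanHalfSpace (n + 1)) M]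
  [T2Space M]
  {EP HP EP' HP' : Type*} [NormedAddCommGroup EP] [NormedSpace ℝ EP] [TopologicalSpace HP]
  {IP : ModelWithCorners ℝ EP HP} [NormedAddCommGroup EP'] [NormedSpace ℝ EP']
  [TopologicalSpace HP'] {IP' : ModelWithCorners ℝ EP' HP'}
  {P : Type*} [TopologicalSpace P] [ChartedSpace HP P]
  {P' : Type*} [TopologicalSpace P'] [ChartedSpace HP' P']
  {ι : Type*} [Finite ι] {h : ι → HandleAttachingMap n k M}

/-- **Two multi-attachments along the same attaching maps are diffeomorphic compatibly with the
pieces**: there is a diffeomorphism `e : P ≅ P'` with `e ∘ jA = jA'` and `e ∘ jB i = jB' i`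
(Kosinski's comparison map between two identification spaces, VI §1, proof of (1.1); the tree's
`IsMultiAttachment.nonempty_diffeomorph` records only its existence).
[cite: Kosinski1993, Ch. VI §1, proof of Thm (1.1)] -/
theorem _root_.Literature.Topology.FourManifolds.HandleAttachingMap.MultiAttachmentData.exists_diffeomorph_apply_eq
    [IsManifold IP ∞ P] [IsManifold IP' ∞ P']
    (D : MultiAttachmentData h IP P) (D' : MultiAttachmentData h IP' P') :
    ∃ e : P ≃ₘ⟮IP, IP'⟯ P', (∀ a, e (D.jA a) = D'.jA a) ∧ ∀ i b, e (D.jB i b) = D'.jB i b := by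
  have hRR' : ∀ i a b, D.jA a = D.jB i b → D'.jA a = D'.jB i b := fun i a b e =>
    (D'.glue i a b).2 ((D.glue i a b).1 e)
  have hR'R : ∀ i a b, D'.jA a = D'.jB i b → D.jA a = D.jB i b := fun i a b e =>
    (D.glue i a b).2 ((D'.glue i a b).1 e)
  obtain ⟨G, hGA, hGB⟩ := exists_map_apply_eq_of_cover_family D.cover D.injective_jA
    D.injective_jB D.disjointB hRR'
  obtain ⟨G', hGA', hGB'⟩ := exists_map_apply_eq_of_cover_family D'.cover D'.injective_jA
    D'.injective_jB D'.disjointB hR'R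
  refine ⟨{ toFun := G
            invFun := G'
            left_inv := fun p => ?_
            right_inv := fun p => ?_
            contMDiff_toFun := contMDiff_of_comp_eq_of_cover_family D.hjA D.hjAo
              (fun i => (D.hjB i).1) (fun i => (D.hjB i).2) D.cover D'.hjA.contMDiff
              (fun i => (D'.hjB i).1.contMDiff) hGA hGB
            contMDiff_invFun := contMDiff_of_comp_eq_of_cover_family D'.hjA D'.hjAo
              (fun i => (D'.hjB i).1) (fun i => (D'.hjB i).2) D'.cover D.hjA.contMDiff
              (fun i => (D.hjB i).1.contMDiff) hGA' hGB' }, hGA, hGB⟩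
  · rcases D.mem_range_or p with ⟨a, rfl⟩ | ⟨i, b, rfl⟩
    · rw [hGA, hGA']
    · rw [hGB, hGB']
  · rcases D'.mem_range_or p with ⟨a, rfl⟩ | ⟨i, b, rfl⟩
    · rw [hGA', hGA]
    · rw [hGB', hGB]

end Compatible

/-! ### The complex tangencies of a transported Stein structure -/

section ContactPlane

variable {P M : Type*} [TopologicalSpace P] [ChartedSpace (EuclideanHalfSpace 4) P]
  [IsManifold (𝓡∂ 4) ∞ P] [CompactSpace P] [TopologicalSpace M]
  [ChartedSpace (EuclideanHalfSpace 4) M] [IsManifold (𝓡∂ 4) ∞ M] [CompactSpace M]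

/-- **The complex tangencies of `S.comap e` are `(De)⁻¹` of those of `S`**: at a boundary point
`x`, `v ∈ ξ_{S.comap e}(x) ↔ De_x v ∈ ξ_S(e x)` (along the boundary `ξ = ker dφ ∩ ker d^ℂφ`,
`SteinStructure.contactPlane_eq`, and `d(φ ∘ e) = dφ ∘ De`, `De ∘ J' = J ∘ De`).
[cite: CieliebakEliashberg2012, Ch. 2] -/
theorem mem_contactPlane_comap_iff (e : P ≃ₘ⟮𝓡∂ 4, 𝓡∂ 4⟯ M) (S : SteinStructure M) {x : P}
    (hx : (𝓡∂ 4).IsBoundaryPoint x) (v : EuclideanSpace ℝ (Fin 4)) :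
    v ∈ contactPlane (S.comap e).J x ↔
      mfderiv (𝓡∂ 4) (𝓡∂ 4) e x v ∈ contactPlane S.J (e x) := by
  have hx' : (𝓡∂ 4).IsBoundaryPoint (e x) :=
    ((e.isLocalDiffeomorph x).isBoundaryPoint_iff (by simp)).1 hx
  rw [(S.comap e).contactPlane_eq hx, S.contactPlane_eq hx']
  have h1 : ∀ w, (S.comap e).dφ x w =
      S.dφ (e x) (mfderiv (𝓡∂ 4) (𝓡∂ 4) e x w) := fun w =>
    mfderiv_phi_comp_apply e S x w
  have h2 : mfderiv (𝓡∂ 4) (𝓡∂ 4) e x ((S.comap e).J x v) =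
      S.J (e x) (mfderiv (𝓡∂ 4) (𝓡∂ 4) e x v) :=
    diffeoDeriv_comapJ e S x v
  change ((S.comap e).dφ x v = 0 ∧ (S.comap e).contactForm x v = 0) ↔
    (S.dφ (e x) (mfderiv (𝓡∂ 4) (𝓡∂ 4) e x v) = 0 ∧
      S.contactForm (e x) (mfderiv (𝓡∂ 4) (𝓡∂ 4) e x v) = 0)
  rw [SteinStructure.contactForm_apply, SteinStructure.contactForm_apply, neg_eq_zero, neg_eq_zero,
    h1, h1, h2]

end ContactPlane

/-! ### Giroux forms for equal plane fields -/

/-- A Giroux form for a plane field is a Giroux form for any pointwise equal plane field.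
[folklore] -/
theorem OpenBook.IsGirouxForm.congr_planeField {N : Type u} [TopologicalSpace N]
    [ChartedSpace (EuclideanSpace ℝ (Fin 3)) N] [IsManifold (𝓡 3) ∞ N] {ob : OpenBook N}
    {ξ ξ' : N → Submodule ℝ (EuclideanSpace ℝ (Fin 3))} {α : MForm (𝓡 3) N ℝ 1}
    (h : ob.IsGirouxForm ξ α) (hξ : ∀ y, ξ y = ξ' y) : ob.IsGirouxForm ξ' α := by
  have heq : ξ = ξ' := funext hξ
  subst heq
  exact h

/-! ### Transport between two models of a Lefschetz handlebody -/

section Transport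

variable {g : ℕ} {ι : Type} [Finite ι]
  {X₀ X : Type} [TopologicalSpace X₀] [T2Space X₀] [ChartedSpace (EuclideanHalfSpace 4) X₀]
  [IsManifold (𝓡∂ 4) ∞ X₀] [CompactSpace X₀]
  [TopologicalSpace X] [T2Space X] [ChartedSpace (EuclideanHalfSpace 4) X]
  [IsManifold (𝓡∂ 4) ∞ X] [CompactSpace X]
  {h : ι → HandleAttachingMap 3 2 (Base g)}
  {D₀ : MultiAttachmentData h (𝓡∂ 4) X₀} {D : MultiAttachmentData h (𝓡∂ 4) X}
  {bX₀ : BoundaryData (𝓡∂ 4) X₀ (𝓡 3)} {bX : BoundaryData (𝓡∂ 4) X (𝓡 3)}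

omit [T2Space X₀] [IsManifold (𝓡∂ 4) ∞ X₀] [CompactSpace X₀] [T2Space X] [IsManifold (𝓡∂ 4) ∞ X]
  [CompactSpace X] in
/-- The restricted diffeomorphism `∂e⁻¹` covers `e⁻¹`: `incl₀ ((∂e)⁻¹ y) = e⁻¹ (incl y)`.
[folklore] -/
theorem incl_restrictDiffeomorph_symm_apply (e : X₀ ≃ₘ⟮𝓡∂ 4, 𝓡∂ 4⟯ X) (y : bX.carrier) :
    bX₀.incl ((bX₀.restrictDiffeomorph bX e).symm y) = e.symm (bX.incl y) :=
  BoundaryData.incl_restrictDiffeomorph (b₁ := bX) (b₂ := bX₀) e.symm y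

omit [T2Space X₀] [IsManifold (𝓡∂ 4) ∞ X₀] [CompactSpace X₀] [T2Space X] [IsManifold (𝓡∂ 4) ∞ X]
  [CompactSpace X] in
/-- **Chain rule along the seam**: `d(incl₀) ∘ d(∂e⁻¹) = d(e⁻¹) ∘ d(incl)` (both are the
differential of `incl₀ ∘ ∂e⁻¹ = e⁻¹ ∘ incl`). [folklore] -/
theorem mfderiv_incl_restrictDiffeomorph_symm (e : X₀ ≃ₘ⟮𝓡∂ 4, 𝓡∂ 4⟯ X) (y : bX.carrier)
    (w : EuclideanSpace ℝ (Fin 3)) :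
    mfderiv (𝓡 3) (𝓡∂ 4) bX₀.incl ((bX₀.restrictDiffeomorph bX e).symm y)
        (mfderiv (𝓡 3) (𝓡 3) (bX₀.restrictDiffeomorph bX e).symm y w) =
      mfderiv (𝓡∂ 4) (𝓡∂ 4) e.symm (bX.incl y) (mfderiv (𝓡 3) (𝓡∂ 4) bX.incl y w) := by
  set φ := bX₀.restrictDiffeomorph bX e with hφ
  have c1 := mfderiv_comp y
    ((bX₀.isSmoothEmbedding.contMDiff (φ.symm y)).mdifferentiableAt (by simp))
    ((φ.symm.contMDiff y).mdifferentiableAt (by simp))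
  have c2 := mfderiv_comp y ((e.symm.contMDiff (bX.incl y)).mdifferentiableAt (by simp))
    ((bX.isSmoothEmbedding.contMDiff y).mdifferentiableAt (by simp))
  have hfun : bX₀.incl ∘ φ.symm = e.symm ∘ bX.incl :=
    funext fun z => incl_restrictDiffeomorph_symm_apply e z
  rw [hfun] at c1
  have h12 := c1.symm.trans c2
  exact ContinuousLinearMap.ext_iff.1 h12 w

omit [T2Space X₀] [T2Space X] in
/-- **The boundary plane field of the transported Stein structure.**  For a Stein structure `S₀`
on `X₀` and a diffeomorphism `e : X₀ ≅ X`, the complex tangencies of `S₀.comap e⁻¹` on `X`,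
pulled back to the boundary datum `bX`, are the transport along `∂e` of those of `S₀` pulled back
to `bX₀`: `ξ(y) = (d(∂e)⁻¹_y)⁻¹ ξ₀((∂e)⁻¹ y)` — the plane field of
`OpenBook.IsGirouxForm.map`. [cite: CieliebakEliashberg2012, Ch. 2] -/
theorem boundaryPlaneField_comap_symm (e : X₀ ≃ₘ⟮𝓡∂ 4, 𝓡∂ 4⟯ X) (S₀ : SteinStructure X₀)
    (y : bX.carrier) :
    boundaryPlaneField (S₀.comap e.symm).J bX y =
      (boundaryPlaneField S₀.J bX₀ ((bX₀.restrictDiffeomorph bX e).symm y)).comap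
        (mfderiv (𝓡 3) (𝓡 3) (bX₀.restrictDiffeomorph bX e).symm y).toLinearMap := by
  ext v
  refine (mem_contactPlane_comap_iff e.symm S₀ (bX.incl_mem_boundary y)
      (mfderiv (𝓡 3) (𝓡∂ 4) bX.incl y v)).trans ?_
  rw [← mfderiv_incl_restrictDiffeomorph_symm e y v, ← incl_restrictDiffeomorph_symm_apply e y]
  exact Iff.rfl

omit [T2Space X₀] [IsManifold (𝓡∂ 4) ∞ X₀] [CompactSpace X₀] [T2Space X] [IsManifold (𝓡∂ 4) ∞ X]
  [CompactSpace X] in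
/-- **A Kas open book is transported to a Kas open book.**  If `ob₀` is the Kas boundary open
book of `(D₀, bX₀)` and `e : X₀ ≅ X` is compatible with the base pieces (`e ∘ D₀.jA = D.jA`),
then `(∂e)_* ob₀` is the Kas boundary open book of `(D, bX)`: (K1)–(K2) are read through
`incl₀ ∘ (∂e)⁻¹ = e⁻¹ ∘ incl`. [cite: Kas1980] -/
theorem IsKasOpenBookOf.map [T2Space bX₀.carrier] (e : X₀ ≃ₘ⟮𝓡∂ 4, 𝓡∂ 4⟯ X)
    (he : ∀ a, e (D₀.jA a) = D.jA a) {ob₀ : OpenBook bX₀.carrier}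
    (hK₀ : IsKasOpenBookOf g h D₀ bX₀.incl ob₀) :
    IsKasOpenBookOf g h D bX.incl (ob₀.map (bX₀.restrictDiffeomorph bX e)) := by
  have hes : ∀ a, e.symm (D.jA a) = D₀.jA a := fun a => by rw [← he, e.symm_apply_apply]
  have key : ∀ (y : bX.carrier) (a : ↥(coresComplement h)),
      bX.incl y = D.jA a ↔ bX₀.incl ((bX₀.restrictDiffeomorph bX e).symm y) = D₀.jA a :=
    fun y a => by
    rw [incl_restrictDiffeomorph_symm_apply]
    constructor
    · intro h1
      rw [h1, hes]
    · intro h1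
      exact e.symm.injective (h1.trans (hes a).symm)
  constructor
  · intro y
    rw [OpenBook.mem_map_binding_iff, hK₀.1]
    exact exists_congr fun a => and_congr_left' (key y a).symm
  · intro y a hya hw
    rw [OpenBook.map_proj, comp_apply]
    exact hK₀.2 _ a ((key y a).1 hya) hw

/-- **The conclusion of `palf_stein_supportedByBoundaryOpenBook` is independent of the model.**
Let `(X₀, D₀)` and `(X, D)` be two Kosinski multi-attachments of the same family `h` of 2-handle
attaching maps on `Base g` (attaching circles in pages), `e : X₀ ≅ X` a diffeomorphism with
`e ∘ D₀.jA = D.jA`, `bX₀`, `bX` boundary data and `ob₀`, `ob` Kas open books.  If `X₀` carries a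
Stein structure `S₀` with a Giroux form `α₀` of `ob₀` for its boundary complex tangencies, positive
on the frames of `∂X₀` coming from positive frames of `∂ Base g`, then `X` carries such a structure
for `ob`: `S = S₀.comap e⁻¹`, `α = ((∂e)⁻¹)^* α₀` (a Giroux form of `(∂e)_* ob₀`,
`OpenBook.IsGirouxForm.map`, hence of `ob`, which has the same binding and fibration,
`IsKasOpenBookOf.isGirouxForm_iff`), and `α ∧ dα` on a frame `u` over `D.jA a` equals
`α₀ ∧ dα₀` on the frame `d(∂e)⁻¹ u` over `D₀.jA a`, which corresponds to the SAME frame `v` of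
`∂ Base g` (`d(e⁻¹) ∘ d(D.jA) = d(D₀.jA)`). [cite: AkbulutOzbagci2001, Thm. 5] -/
theorem palf_conclusion_transport (e : X₀ ≃ₘ⟮𝓡∂ 4, 𝓡∂ 4⟯ X) (he : ∀ a, e (D₀.jA a) = D.jA a)
    (hpage : ∀ i, ∃ c : ℂ, ‖c‖ = 1 ∧ ∀ θ, (h i).attachingCircle θ ∈ page g c)
    {ob₀ : OpenBook bX₀.carrier} {ob : OpenBook bX.carrier}
    (hK₀ : IsKasOpenBookOf g h D₀ bX₀.incl ob₀) (hK : IsKasOpenBookOf g h D bX.incl ob)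
    (S₀ : SteinStructure X₀) (α₀ : MForm (𝓡 3) bX₀.carrier ℝ 1)
    (hG₀ : ob₀.IsGirouxForm (boundaryPlaneField S₀.J bX₀) α₀)
    (hpos₀ : ∀ (y : bX₀.carrier) (a : ↥(coresComplement h))
      (u : Fin 3 → EuclideanSpace ℝ (Fin 3)) (v : Fin 3 → EuclideanSpace ℝ (Fin 4)),
      bX₀.incl y = D₀.jA a →
      (∀ k, mfderiv (𝓡 3) (𝓡∂ 4) bX₀.incl y (u k) = mfderiv (𝓡∂ 4) (𝓡∂ 4) D₀.jA a (v k)) →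
      IsPosBdryFrame h a v →
      0 < wedge₁₂ (α₀ y) (mextDeriv α₀ y) (u 0) (u 1) (u 2)) :
    ∃ (S : SteinStructure X) (α : MForm (𝓡 3) bX.carrier ℝ 1),
      ob.IsGirouxForm (boundaryPlaneField S.J bX) α ∧
      ∀ (y : bX.carrier) (a : ↥(coresComplement h)) (u : Fin 3 → EuclideanSpace ℝ (Fin 3))
        (v : Fin 3 → EuclideanSpace ℝ (Fin 4)),
        bX.incl y = D.jA a →
        (∀ k, mfderiv (𝓡 3) (𝓡∂ 4) bX.incl y (u k) = mfderiv (𝓡∂ 4) (𝓡∂ 4) D.jA a (v k)) →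
        IsPosBdryFrame h a v →
        0 < wedge₁₂ (α y) (mextDeriv α y) (u 0) (u 1) (u 2) := by
  haveI : T2Space bX₀.carrier := bX₀.isSmoothEmbedding.isEmbedding.t2Space
  haveI : T2Space bX.carrier := bX.isSmoothEmbedding.isEmbedding.t2Space
  set φ := bX₀.restrictDiffeomorph bX e with hφ
  have hes : ∀ a, e.symm (D.jA a) = D₀.jA a := fun a => by rw [← he, e.symm_apply_apply]
  refine ⟨S₀.comap e.symm, α₀.pullback (𝓡 3) φ.symm, ?_, ?_⟩
  · -- the Giroux form of the transported open book, transferred to `ob`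
    have h1 := (hG₀.map ob₀ φ).congr_planeField
      fun y => (boundaryPlaneField_comap_symm e S₀ y).symm
    exact (hK.isGirouxForm_iff hpage (hK₀.map e he) _ _).1 h1
  · -- positivity of `α ∧ dα` on frames coming from positive frames of `∂ Base g`
    intro y a u v hya hd hfr
    rw [OpenBook.wedge₁₂_pullback_symm φ hG₀.smooth]
    refine hpos₀ (φ.symm y) a (fun k => mfderiv (𝓡 3) (𝓡 3) φ.symm y (u k)) v ?_ ?_ hfr
    · rw [incl_restrictDiffeomorph_symm_apply, hya, hes]
    · intro k
      rw [mfderiv_incl_restrictDiffeomorph_symm e y (u k), hd k]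
      have gen : ∀ p : X, p = D.jA a →
          mfderiv (𝓡∂ 4) (𝓡∂ 4) e.symm p (mfderiv (𝓡∂ 4) (𝓡∂ 4) D.jA a (v k)) =
            mfderiv (𝓡∂ 4) (𝓡∂ 4) D₀.jA a (v k) := by
        rintro p rfl
        have hc := mfderiv_comp a ((e.symm.contMDiff (D.jA a)).mdifferentiableAt (by simp))
          ((D.hjA.contMDiff a).mdifferentiableAt (by simp))
        have hfun : (e.symm : X → X₀) ∘ D.jA = D₀.jA := funext hes
        rw [hfun] at hc
        exact (ContinuousLinearMap.ext_iff.1 hc (v k)).symm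
      exact gen _ hya

/-- **Model independence of the conclusion** (without a chosen diffeomorphism): any two Kosinski
multi-attachments of the same family are compatibly diffeomorphic
(`MultiAttachmentData.exists_diffeomorph_apply_eq`), so the conclusion of
`palf_stein_supportedByBoundaryOpenBook` for one model `(X₀, D₀, bX₀, ob₀)` gives it for every
model `(X, D, bX, ob)`. [cite: AkbulutOzbagci2001, Thm. 5] -/
theorem palf_conclusion_of_model
    (hpage : ∀ i, ∃ c : ℂ, ‖c‖ = 1 ∧ ∀ θ, (h i).attachingCircle θ ∈ page g c)
    {ob₀ : OpenBook bX₀.carrier} {ob : OpenBook bX.carrier}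
    (hK₀ : IsKasOpenBookOf g h D₀ bX₀.incl ob₀) (hK : IsKasOpenBookOf g h D bX.incl ob)
    (H₀ : ∃ (S₀ : SteinStructure X₀) (α₀ : MForm (𝓡 3) bX₀.carrier ℝ 1),
      ob₀.IsGirouxForm (boundaryPlaneField S₀.J bX₀) α₀ ∧
      ∀ (y : bX₀.carrier) (a : ↥(coresComplement h)) (u : Fin 3 → EuclideanSpace ℝ (Fin 3))
        (v : Fin 3 → EuclideanSpace ℝ (Fin 4)),
        bX₀.incl y = D₀.jA a →
        (∀ k, mfderiv (𝓡 3) (𝓡∂ 4) bX₀.incl y (u k) = mfderiv (𝓡∂ 4) (𝓡∂ 4) D₀.jA a (v k)) →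
        IsPosBdryFrame h a v →
        0 < wedge₁₂ (α₀ y) (mextDeriv α₀ y) (u 0) (u 1) (u 2)) :
    ∃ (S : SteinStructure X) (α : MForm (𝓡 3) bX.carrier ℝ 1),
      ob.IsGirouxForm (boundaryPlaneField S.J bX) α ∧
      ∀ (y : bX.carrier) (a : ↥(coresComplement h)) (u : Fin 3 → EuclideanSpace ℝ (Fin 3))
        (v : Fin 3 → EuclideanSpace ℝ (Fin 4)),
        bX.incl y = D.jA a →
        (∀ k, mfderiv (𝓡 3) (𝓡∂ 4) bX.incl y (u k) = mfderiv (𝓡∂ 4) (𝓡∂ 4) D.jA a (v k)) →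
        IsPosBdryFrame h a v →
        0 < wedge₁₂ (α y) (mextDeriv α y) (u 0) (u 1) (u 2) := by
  obtain ⟨e, he, -⟩ := D₀.exists_diffeomorph_apply_eq D
  obtain ⟨S₀, α₀, hG₀, hpos₀⟩ := H₀
  exact palf_conclusion_transport e he hpage hK₀ hK S₀ α₀ hG₀ hpos₀

end Transport

/-! ### The fact reduces to one model per attaching datum -/

/-- **`palf_stein_supportedByBoundaryOpenBook` follows from its conclusion on ONE model of each
positive allowable Lefschetz handlebody.**  If for every genus `g` and every family `h` of 2-handle
attaching maps on `Base g` with attaching circles in pages, non-zero shadows and page twisting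
`-1` there is SOME compact multi-attachment `(X₀, D₀)` with SOME boundary datum `bX₀` and SOME Kas
open book `ob₀` for which `X₀` carries a Stein structure with a Giroux form of `ob₀`, positive for
the complex boundary orientation, then the named fact holds (for all models, boundary data and Kas
open books): `palf_conclusion_of_model`. [cite: AkbulutOzbagci2001, Thm. 5] -/
theorem palf_stein_supportedByBoundaryOpenBook_of_models
    (H : ∀ (g : ℕ) (ι : Type) [Finite ι] (h : ι → HandleAttachingMap 3 2 (Base g)),
      (∀ i, ∃ c : ℂ, ‖c‖ = 1 ∧ ∀ θ, (h i).attachingCircle θ ∈ page g c) →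
      (∀ i, shadow g (h i).attachingCircle (h i).continuous_attachingCircle ≠ 0) →
      (∀ i, pageTwisting g (h i).attachingCircle (h i).attachingFraming = -1) →
      ∃ (X₀ : Type) (_ : TopologicalSpace X₀) (_ : T2Space X₀)
        (_ : ChartedSpace (EuclideanHalfSpace 4) X₀) (_ : IsManifold (𝓡∂ 4) ∞ X₀)
        (_ : CompactSpace X₀) (D₀ : MultiAttachmentData h (𝓡∂ 4) X₀)
        (bX₀ : BoundaryData (𝓡∂ 4) X₀ (𝓡 3)) (ob₀ : OpenBook bX₀.carrier),
        IsKasOpenBookOf g h D₀ bX₀.incl ob₀ ∧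
        ∃ (S₀ : SteinStructure X₀) (α₀ : MForm (𝓡 3) bX₀.carrier ℝ 1),
          ob₀.IsGirouxForm (boundaryPlaneField S₀.J bX₀) α₀ ∧
          ∀ (y : bX₀.carrier) (a : ↥(coresComplement h))
            (u : Fin 3 → EuclideanSpace ℝ (Fin 3)) (v : Fin 3 → EuclideanSpace ℝ (Fin 4)),
            bX₀.incl y = D₀.jA a →
            (∀ k, mfderiv (𝓡 3) (𝓡∂ 4) bX₀.incl y (u k) =
              mfderiv (𝓡∂ 4) (𝓡∂ 4) D₀.jA a (v k)) →
            IsPosBdryFrame h a v →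
            0 < wedge₁₂ (α₀ y) (mextDeriv α₀ y) (u 0) (u 1) (u 2)) :
    palf_stein_supportedByBoundaryOpenBook := by
  intro g ι _ X _ _ _ _ _ _ h D bX ob hpage hsh htw hK
  obtain ⟨X₀, _, _, _, _, _, D₀, bX₀, ob₀, hK₀, H₀⟩ := H g ι h hpage hsh htw
  exact palf_conclusion_of_model hpage hK₀ hK H₀

end Literature.Geometry.Symplectic

end
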